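import Summits.QuantumFields.YangMills.Theorems.BalabanLadderIRcofSchurFejerSplit
import HarnessLib

/-!
# Schur–Fejér splitting — §6 (6a–6b): TWIST CHARACTERS and their Fejér windows; products of twist characters

Ideator `ym-ir-idea-22` g4 · crux `IRcof` (stmt-QuantumFields-26930) · row 47 stub S2ᵛ; source `Cruxes/IRcof/Lines/equipartition_seam_SchurFejerCore.lean`
rev 8 (c954a4ca1dd2d859) §6 «arbitrary faithful `ρH`: twist characters, the isotypic Schur monomial, generation», extracted VERBATIM by the custody LEAD
ym-ir-line-ab-p1 g7 (LEAD LANE PROTOCOL (b); critic ym-ir-crit-3 g4 «LAND-ASK #4 WORD = GO» 22:06:44Z, K1‴–K4‴).  The 400-line cap forces THREE files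
(`…SchurFejerTwistChar` = 6a–6b + algebra, `…SchurFejerIsotypic` = isotypic amplitudes ∕ projections ∕ characters + the Schur monomial,
`…SchurFejerCyclicKer` = generation + ★ `splitVanishingAt_of_cyclic_ker`); this file: `IsTwistChar k₀ ω u` (continuous positive-type class function with `u 1 = 1`, `u h⁻¹ = conj (u h)`, twist `u (k₀ h) = ω u h`; `norm_le_one_of_gram`), its window `windowOf u N = Re G_N(u h)∕N²` with the eight split-window clauses (`windowOf_exact`: exact `Γ`-average), and the algebra `isTwistChar_one ∕ .mul ∕ .pow ∕ .prod`.
Same namespace `…EquipartitionSeam.SchurFejer` (no wholesale `open` downstream).  Gate-forced only: one-line docstrings where the lint requires them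
(and `private` on a tree-duplicate if the dedup gate names one).  HONEST: the located lemma S2ᵛ of one registered line, proved on the cyclic-kernel sub-class;
walls S3 ∕ S5ᵛ untouched; width 0; YM mass gap (Clay) NOT proved; `IRcof` 0∕1; R4 = `BalabanLadder.UV` only.
-/

set_option autoImplicit false

noncomputable section

open Finset Complex

namespace Summit.QuantumFields.YangMills.Cruxes.IRcof.EquipartitionSeam.SchurFejer

open scoped ComplexOrder Matrix

section TwistChar

open Literature.MathematicalPhysics.QuantumFieldTheory
open Summit.QuantumFields.YangMills.Theorems.NonSimplyConnectedLatticeGap (latticeRep_map_inv)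

variable {H : Type} [Group H] [TopologicalSpace H]

/-- A **twist character** for `(k₀, ω)`: a continuous positive-type class function `u : H → ℂ` with `u 1 = 1`,
`u (h⁻¹) = conj (u h)` and the twist `u (k₀ h) = ω · u h`.  (`|u| ≤ 1` follows, `IsTwistChar.norm_le_one`.) -/
def IsTwistChar (k₀ : H) (ω : ℂ) (u : H → ℂ) : Prop :=
  Continuous u ∧ u 1 = 1 ∧ (∀ h, u h⁻¹ = starRingEnd ℂ (u h)) ∧ (∀ g h, u (g * h * g⁻¹) = u h) ∧
    (∀ h, u (k₀ * h) = ω * u h) ∧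
    (∀ (n : ℕ) (x : Fin n → H), (Matrix.of fun i j : Fin n => u ((x i)⁻¹ * x j)).PosSemidef)

namespace IsTwistChar

variable {k₀ : H} {ω : ℂ} {u : H → ℂ}

/-- A twist character is continuous. -/
theorem continuous (hu : IsTwistChar k₀ ω u) : Continuous u := hu.1

/-- A twist character takes the value `1` at `1`. -/
theorem one (hu : IsTwistChar k₀ ω u) : u 1 = 1 := hu.2.1

/-- `u h⁻¹ = conj (u h)` for a twist character. -/
theorem inv (hu : IsTwistChar k₀ ω u) (h : H) : u h⁻¹ = starRingEnd ℂ (u h) := hu.2.2.1 h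

/-- A twist character is a class function. -/
theorem conj (hu : IsTwistChar k₀ ω u) (g h : H) : u (g * h * g⁻¹) = u h := hu.2.2.2.1 g h

/-- The twist rule `u (k₀ h) = ω · u h`. -/
theorem twist (hu : IsTwistChar k₀ ω u) (h : H) : u (k₀ * h) = ω * u h := hu.2.2.2.2.1 h

/-- Gram matrices of a twist character are positive semidefinite. -/
theorem gram (hu : IsTwistChar k₀ ω u) (n : ℕ) (x : Fin n → H) :
    (Matrix.of fun i j : Fin n => u ((x i)⁻¹ * x j)).PosSemidef := hu.2.2.2.2.2 n x

end IsTwistChar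

omit [TopologicalSpace H] in
/-- Positive type + `u 1 = 1` ⇒ `|u| ≤ 1` (the `2 × 2` Gram matrix at `(1, h)`, test vector `(1, −conj u(h))`). -/
theorem norm_le_one_of_gram {u : H → ℂ} (h1 : u 1 = 1) (hinv : ∀ h, u h⁻¹ = starRingEnd ℂ (u h))
    (hgram : ∀ (n : ℕ) (x : Fin n → H), (Matrix.of fun i j : Fin n => u ((x i)⁻¹ * x j)).PosSemidef)
    (h : H) : ‖u h‖ ≤ 1 := by
  have hG := (hgram 2 ![1, h]).dotProduct_mulVec_nonneg ![1, -starRingEnd ℂ (u h)]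
  have hexp : dotProduct (star ![(1 : ℂ), -starRingEnd ℂ (u h)])
      (Matrix.mulVec (Matrix.of fun i j : Fin 2 => u ((![1, h] i)⁻¹ * ![1, h] j))
        ![1, -starRingEnd ℂ (u h)]) = ((1 - ‖u h‖ ^ 2 : ℝ) : ℂ) := by
    simp only [dotProduct, Matrix.mulVec, Matrix.of_apply, Fin.sum_univ_two, Matrix.cons_val_zero,
      Matrix.cons_val_one, Pi.star_apply, inv_one, one_mul, mul_one, h1, Complex.star_def, map_one,
      map_neg, Complex.conj_conj, inv_mul_cancel, hinv]
    rw [Complex.ofReal_sub, Complex.ofReal_one, ← Complex.normSq_eq_norm_sq, ← Complex.mul_conj]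
    ring
  rw [hexp, Complex.zero_le_real] at hG
  nlinarith [norm_nonneg (u h)]

/-- `IsTwistChar.norm_le_one` (see the module docstring; verbatim from the Lines core §6). -/
theorem IsTwistChar.norm_le_one {k₀ : H} {ω : ℂ} {u : H → ℂ} (hu : IsTwistChar k₀ ω u) (h : H) :
    ‖u h‖ ≤ 1 :=
  norm_le_one_of_gram hu.one hu.inv hu.gram h

omit [TopologicalSpace H] in
/-- `IsTwistChar.twist_pow` (see the module docstring; verbatim from the Lines core §6). -/
theorem IsTwistChar.twist_pow {k₀ : H} {ω : ℂ} {u : H → ℂ} (hu : ∀ h, u (k₀ * h) = ω * u h)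
    (m : ℕ) (h : H) : u (k₀ ^ m * h) = ω ^ m * u h := by
  induction m with
  | zero => simp
  | succ m ih => rw [pow_succ', mul_assoc, hu, ih, pow_succ', mul_assoc]

/-- The window of a twist character: `W(h) = Re G_N(u(h)) / N²`. -/
def windowOf (u : H → ℂ) (N : ℕ) (h : H) : ℝ := (fejerSum (u h) N).re / (N : ℝ) ^ 2

omit [Group H] in
/-- `continuous_windowOf` (see the module docstring; verbatim from the Lines core §6). -/
theorem continuous_windowOf {u : H → ℂ} (hu : Continuous u) (N : ℕ) : Continuous (windowOf u N) :=
  (Complex.continuous_re.comp ((continuous_fejerSum N).comp hu)).div_const _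

omit [Group H] [TopologicalSpace H] in
/-- `windowOf_nonneg` (see the module docstring; verbatim from the Lines core §6). -/
theorem windowOf_nonneg {u : H → ℂ} (hu : ∀ h, ‖u h‖ ≤ 1) (N : ℕ) (h : H) : 0 ≤ windowOf u N h :=
  div_nonneg (fejerSum_re_nonneg _ (hu h) N) (sq_nonneg _)

omit [Group H] [TopologicalSpace H] in
/-- `windowOf_le_one` (see the module docstring; verbatim from the Lines core §6). -/
theorem windowOf_le_one {u : H → ℂ} (hu : ∀ h, ‖u h‖ ≤ 1) (N : ℕ) (h : H) : windowOf u N h ≤ 1 := by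
  unfold windowOf
  rcases Nat.eq_zero_or_pos N with h0 | hpos
  · simp [h0]
  · exact (div_le_one (by positivity)).2 (fejerSum_re_le _ (hu h) N)

omit [TopologicalSpace H] in
/-- `windowOf_inv` (see the module docstring; verbatim from the Lines core §6). -/
theorem windowOf_inv {u : H → ℂ} (hu : ∀ h, u h⁻¹ = starRingEnd ℂ (u h)) (N : ℕ) (h : H) :
    windowOf u N h⁻¹ = windowOf u N h := by
  simp only [windowOf, hu, fejerSum_conj_re]

omit [TopologicalSpace H] in
/-- `windowOf_conj` (see the module docstring; verbatim from the Lines core §6). -/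
theorem windowOf_conj {u : H → ℂ} (hu : ∀ g h, u (g * h * g⁻¹) = u h) (N : ℕ) (g h : H) :
    windowOf u N (g * h * g⁻¹) = windowOf u N h := by
  simp only [windowOf, hu]

omit [TopologicalSpace H] in
/-- `windowOf_one` (see the module docstring; verbatim from the Lines core §6). -/
theorem windowOf_one {u : H → ℂ} (hu : u 1 = 1) {N : ℕ} (hN : 0 < N) : windowOf u N 1 = 1 := by
  unfold windowOf
  rw [hu, fejerSum_one, natCast_sq_re]
  exact div_self (by positivity)

omit [TopologicalSpace H] in
/-- EXACTNESS over the `N` rotations by `k₀`. -/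
theorem windowOf_exact_range {k₀ : H} {ω : ℂ} {u : H → ℂ} (hu : ∀ h, u (k₀ * h) = ω * u h) {N : ℕ}
    (hN : 0 < N) (hω : IsPrimitiveRoot ω N) (h : H) :
    ∑ m ∈ range N, windowOf u N (k₀ ^ m * h) = 1 := by
  unfold windowOf
  simp_rw [IsTwistChar.twist_pow hu]
  rw [← Finset.sum_div, ← Complex.re_sum, fejerSum_exact ω _ N hω, natCast_sq_re]
  exact div_self (by positivity)

omit [TopologicalSpace H] in
/-- Gram matrices of the window of a positive-type `u` are PSD. -/
theorem posSemidef_windowOf_gram {u : H → ℂ}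
    (hgram : ∀ (n : ℕ) (x : Fin n → H), (Matrix.of fun i j : Fin n => u ((x i)⁻¹ * x j)).PosSemidef)
    (N : ℕ) {n : ℕ} (x : Fin n → H) :
    (Matrix.of fun i j : Fin n => ((windowOf u N ((x i)⁻¹ * x j) : ℝ) : ℂ)).PosSemidef := by
  have hF := posSemidef_fejerSum (hgram n x) N
  have hc : (0 : ℂ) ≤ ((((N : ℝ) ^ 2)⁻¹ : ℝ) : ℂ) := Complex.zero_le_real.2 (inv_nonneg.2 (sq_nonneg _))
  have heq : (Matrix.of fun i j : Fin n => ((windowOf u N ((x i)⁻¹ * x j) : ℝ) : ℂ)) =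
      ((((N : ℝ) ^ 2)⁻¹ : ℝ) : ℂ) •
        Matrix.of fun i j : Fin n => fejerSum (u ((x i)⁻¹ * x j)) N := by
    ext i j
    simp only [Matrix.of_apply, Matrix.smul_apply, smul_eq_mul, windowOf, Complex.ofReal_div,
      ofReal_fejerSum_re, Complex.ofReal_inv]
    rw [div_eq_inv_mul]
  rw [heq]
  exact hF.smul hc

omit [TopologicalSpace H] in
/-- `windowOf_posType` (see the module docstring; verbatim from the Lines core §6). -/
theorem windowOf_posType {u : H → ℂ}
    (hgram : ∀ (n : ℕ) (x : Fin n → H), (Matrix.of fun i j : Fin n => u ((x i)⁻¹ * x j)).PosSemidef)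
    (N : ℕ) (n : ℕ) (x : Fin n → H) (v : Fin n → ℂ) :
    0 ≤ (∑ i, ∑ j, (starRingEnd ℂ) (v i) * v j * ((windowOf u N ((x i)⁻¹ * x j) : ℝ) : ℂ)).re := by
  have hq := (posSemidef_windowOf_gram hgram N x).dotProduct_mulVec_nonneg v
  have hexp : (∑ i, ∑ j, (starRingEnd ℂ) (v i) * v j * ((windowOf u N ((x i)⁻¹ * x j) : ℝ) : ℂ)) =
      dotProduct (star v)
        (Matrix.mulVec (Matrix.of fun i j : Fin n => ((windowOf u N ((x i)⁻¹ * x j) : ℝ) : ℂ)) v) := by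
    simp only [dotProduct, Matrix.mulVec, Matrix.of_apply, Pi.star_apply, Complex.star_def,
      Finset.mul_sum]
    refine Finset.sum_congr rfl fun i _ => Finset.sum_congr rfl fun j _ => ?_
    ring
  rw [hexp]
  exact (Complex.nonneg_iff.1 hq).1

omit [TopologicalSpace H] in
/-- EXACTNESS over the cyclic group `Γ = ⟨k₀⟩`. -/
theorem windowOf_exact {k₀ : H} {ω : ℂ} {u : H → ℂ} (hu : ∀ h, u (k₀ * h) = ω * u h)
    (Γ : Subgroup H) (hΓ : Γ = Subgroup.zpowers k₀) {N : ℕ} (hN : orderOf k₀ = N) (hNpos : 0 < N)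
    (hω : IsPrimitiveRoot ω N) (h : H) :
    ∑ᶠ k ∈ (Γ : Set H), windowOf u N (k * h) = 1 := by
  classical
  have hfin : IsOfFinOrder k₀ := orderOf_pos_iff.1 (hN ▸ hNpos)
  have hset : (Γ : Set H) = ↑((Finset.range N).image (k₀ ^ ·)) := by
    ext y
    rw [hΓ, SetLike.mem_coe, hfin.mem_zpowers_iff_mem_range_orderOf, hN, Finset.mem_coe]
  rw [hset, finsum_mem_coe_finset, Finset.sum_image]
  · exact windowOf_exact_range hu hNpos hω h
  · intro a ha b hb hab
    have ha' : a < N := by simpa using ha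
    have hb' : b < N := by simpa using hb
    exact pow_injOn_Iio_orderOf (Set.mem_Iio.2 (hN ▸ ha')) (Set.mem_Iio.2 (hN ▸ hb')) hab

end TwistChar

section Algebra

variable {H : Type} [Group H] [TopologicalSpace H]

/-- The constant `1` is a twist character for the trivial twist. -/
theorem isTwistChar_one (k₀ : H) : IsTwistChar k₀ 1 (1 : H → ℂ) := by
  refine ⟨continuous_const, rfl, fun h => by simp, fun g h => rfl, fun h => by simp, fun n x => ?_⟩
  have h : (Matrix.of fun i j : Fin n => (1 : H → ℂ) ((x i)⁻¹ * x j)) =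
      Matrix.vecMulVec (star (fun _ : Fin n => (1 : ℂ))) (fun _ => (1 : ℂ)) := by
    ext i j
    simp [Matrix.vecMulVec_apply]
  rw [h]
  exact Matrix.posSemidef_vecMulVec_star_self _

/-- Twist characters multiply (Schur product theorem for the Gram matrices); the twists multiply. -/
theorem IsTwistChar.mul {k₀ : H} {ω₁ ω₂ : ℂ} {u₁ u₂ : H → ℂ} (h₁ : IsTwistChar k₀ ω₁ u₁)
    (h₂ : IsTwistChar k₀ ω₂ u₂) : IsTwistChar k₀ (ω₁ * ω₂) (u₁ * u₂) := by
  refine ⟨h₁.continuous.mul h₂.continuous, ?_, fun h => ?_, fun g h => ?_, fun h => ?_, fun n x => ?_⟩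
  · simp [h₁.one, h₂.one]
  · simp [h₁.inv, h₂.inv]
  · simp [h₁.conj, h₂.conj]
  · simp only [Pi.mul_apply, h₁.twist, h₂.twist]
    ring
  · have h : (Matrix.of fun i j : Fin n => (u₁ * u₂) ((x i)⁻¹ * x j)) =
        Matrix.hadamard (Matrix.of fun i j : Fin n => u₁ ((x i)⁻¹ * x j))
          (Matrix.of fun i j : Fin n => u₂ ((x i)⁻¹ * x j)) := by
      ext i j
      simp [Matrix.hadamard]
    rw [h]
    exact (h₁.gram n x).hadamard (h₂.gram n x)

/-- Powers of a twist character. -/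
theorem IsTwistChar.pow {k₀ : H} {ω : ℂ} {u : H → ℂ} (hu : IsTwistChar k₀ ω u) (b : ℕ) :
    IsTwistChar k₀ (ω ^ b) (u ^ b) := by
  induction b with
  | zero => simpa using isTwistChar_one k₀
  | succ b ih => simpa [pow_succ] using ih.mul hu

/-- Finite products of twist characters (Schur monomials). -/
theorem IsTwistChar.prod {k₀ : H} {ι : Type} (s : Finset ι) {ω : ι → ℂ} {u : ι → H → ℂ}
    (hu : ∀ i ∈ s, IsTwistChar k₀ (ω i) (u i)) : IsTwistChar k₀ (∏ i ∈ s, ω i) (∏ i ∈ s, u i) := by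
  classical
  induction s using Finset.induction_on with
  | empty => simpa using isTwistChar_one k₀
  | insert a s ha ih =>
      rw [Finset.prod_insert ha, Finset.prod_insert ha]
      exact (hu a (Finset.mem_insert_self a s)).mul
        (ih fun i hi => hu i (Finset.mem_insert_of_mem hi))

end Algebra

end Summit.QuantumFields.YangMills.Cruxes.IRcof.EquipartitionSeam.SchurFejer

end
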